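import Summits.Ventures.Crystal3D.Theorems.StickyWulffConstantStackingLiminfChimeraStackWulff
import Summits.Ventures.Crystal3D.Theorems.StickyWulffConstantPolycrystalWulffBoundBasalLamellarFrames
import Summits.Ventures.Crystal3D.Theorems.StickyWulffConstantPolycrystalWulffBoundFreeEnergyExterior

/-!
# `PolycrystalWulffBound`, rung `rung_basalLamellar` — step 1: the CHIMERA lower bound for
# basal-lamellar co-axial textures (line `PolyDensity`, crux `stmt-Ventures-19482`)

Route `StickyWulffConstant` of the venture `Summits/Ventures/Crystal3D`, second prover lane (poly-p2,
gen 3).  The rung `rung_basalLamellar` bounds the FREE energy of a set `E` cut by parallel planes `⊥ m`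
into lamellae `G_f` carrying pairwise co-axial frames `A_f`.  This file proves the volume half of a
Brunn–Minkowski route to it (replacing the Knothe map of the line card and the lattice discretisation
of ROUTE §72.6): for every `r > 0` and every measurable `C` containing the «chimera neighbourhood»
`⋃_f (G_f + r·W(A_f))` (each lamella thickened by ITS OWN Wulff body),

  `|E'|^{1/3} + r·32^{1/3} ≤ |C|^{1/3}`,   `E' = ⋃_f G_f`

(`lamellar_chimera_lower`).  It is the SL line's chimera Brunn–Minkowski inequality
(`Chimera.chimera3_brunnMinkowski`: height-dependent summand with dominating sections) after three
identifications: (i) the self-clause `Ax m (A f) (A f)` gives `W(A f) = M_f '' W₁` with `M_f e₂ = ±m`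
(`exists_frame_cruxWulffBody`); (ii) in the coordinates `x ↦ (L₀⁻¹ x)ᵢ` (`L₀ e₂ = m`) all bodies are
images of `r·W₁` under linear isometries fixing the vertical axis up to sign, whose horizontal sections
are planar isometric images of those of `r·W₁` — equal areas (`volume_slice3_image_eq`; the central
symmetry `−W₁ = W₁` absorbs the sign); (iii) `|W₁| = 32`.
The matching upper bound `|C_r| ≤ |E'| + r·Fr + o(r)` for polyhedral `E` (anisotropic Minkowski
content of the lamellar texture) is NOT here.
WHAT THIS IS NOT: the rung; nothing on perimeters; the crux is not claimed.
-/

noncomputable section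

open scoped BigOperators InnerProductSpace ENNReal Pointwise
open MeasureTheory Set

namespace Summit.Ventures.Crystal3D.Theorems

open Summit.Ventures.Crystal3D.Cruxes.TextureLiminf.TexShadow (E3)
open Literature.MathematicalPhysics.StatisticalMechanics (fccStacking barlowStacking IsHaggSeq)

/-! ### Horizontal sections of isometric images fixing the vertical axis -/

/-- **Sections of an isometric image fixing the vertical axis up to sign have the same area.**
For a linear isometry `N` of `E3` with `N e₂ = ε e₂` (`ε = ±1`) and an origin-symmetric measurable
`S`, every horizontal section of `N '' S` (read in `Fin 3 → ℝ`) has the same planar measure as the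
corresponding section of `S`. -/
theorem volume_slice3_image_eq (N : E3 ≃ₗᵢ[ℝ] E3) {ε : ℝ} (hε : ε = 1 ∨ ε = -1)
    (hN : N (EuclideanSpace.single (2 : Fin 3) 1) = ε • EuclideanSpace.single (2 : Fin 3) (1 : ℝ))
    {S : Set E3} (hS : MeasurableSet S) (hSsymm : -S = S) (u : ℝ) :
    volume {p : ℝ × ℝ | (![p.1, p.2, u] : Fin 3 → ℝ) ∈
        ((MeasurableEquiv.toLp 2 (Fin 3 → ℝ)).symm) '' (N '' S)} =
      volume {p : ℝ × ℝ | (![p.1, p.2, u] : Fin 3 → ℝ) ∈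
        ((MeasurableEquiv.toLp 2 (Fin 3 → ℝ)).symm) '' S} := by
  set meq := (MeasurableEquiv.toLp 2 (Fin 3 → ℝ)).symm with hmeq
  set e₂ : E3 := EuclideanSpace.single (2 : Fin 3) (1 : ℝ) with he₂
  have hε2 : ε * ε = 1 := by rcases hε with h | h <;> rw [h] <;> norm_num
  -- the vertical coordinate
  have hN2 : ∀ y : E3, (N y) 2 = ε * y 2 := by
    intro y
    have h1 : (N y) 2 = ⟪N y, e₂⟫_ℝ := by
      rw [he₂, EuclideanSpace.inner_single_right]; simp
    have h2 : y 2 = ⟪y, e₂⟫_ℝ := by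
      rw [he₂, EuclideanSpace.inner_single_right]; simp
    have h3 : e₂ = ε • N e₂ := by
      rw [hN, smul_smul, hε2, one_smul]
    rw [h1, h3, real_inner_smul_right, LinearIsometryEquiv.inner_map_map, ← h2]
  -- points of `E3` by planar coordinates and height
  set pt : ℝ × ℝ → ℝ → E3 := fun q v => meq.symm (![q.1, q.2, v] : Fin 3 → ℝ) with hpt
  have hpt0 : ∀ q v, (pt q v) 0 = q.1 := fun q v => rfl
  have hpt1 : ∀ q v, (pt q v) 1 = q.2 := fun q v => rfl
  have hpt2 : ∀ q v, (pt q v) 2 = v := fun q v => rfl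
  have hpt_eq : ∀ y : E3, pt (y 0, y 1) (y 2) = y := by
    intro y
    ext i
    fin_cases i <;> rfl
  have hpt_add : ∀ q v, pt q v = pt q 0 + v • e₂ := by
    intro q v
    ext i
    fin_cases i <;> simp [hpt, hmeq, he₂]
  -- the planar part `ψ` of `N`
  set ψ : ℝ × ℝ → ℝ × ℝ := fun q => ((N (pt q 0)) 0, (N (pt q 0)) 1) with hψ
  have hNpt : ∀ q v, N (pt q v) = pt (ψ q) (ε * v) := by
    intro q v
    rw [hpt_add q v, map_add, map_smul, hN, smul_smul]
    ext i
    fin_cases i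
    · simp [hψ, hpt0, he₂]
    · simp [hψ, hpt1, he₂]
    · simp [he₂, hpt2]
      show (N (pt q 0)) 2 + v * ε = (pt (ψ q) (ε * v)) 2
      rw [hpt2, hN2, hpt2, mul_zero, zero_add, mul_comm]
  -- membership in the transported sets
  have hmem : ∀ (X : Set E3) (q : ℝ × ℝ) (v : ℝ),
      (![q.1, q.2, v] : Fin 3 → ℝ) ∈ meq '' X ↔ pt q v ∈ X := by
    intro X q v
    rw [MeasurableEquiv.image_eq_preimage_symm, mem_preimage]
  -- the section of `N '' S` at height `u` is the `ψ`-image of the section of `S` at height `ε u`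
  have hslice : {p : ℝ × ℝ | (![p.1, p.2, u] : Fin 3 → ℝ) ∈ meq '' (N '' S)} =
      ψ '' {q : ℝ × ℝ | (![q.1, q.2, ε * u] : Fin 3 → ℝ) ∈ meq '' S} := by
    ext p
    simp only [mem_setOf_eq, hmem, mem_image]
    constructor
    · rintro ⟨y, hy, hyp⟩
      refine ⟨(y 0, y 1), ?_, ?_⟩
      · have hv : y 2 = ε * u := by
          have := congrArg (fun z : E3 => z 2) hyp
          simp only at this
          rw [hN2, hpt2] at this
          calc y 2 = ε * (ε * y 2) := by rw [← mul_assoc, hε2, one_mul]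
            _ = ε * u := by rw [this]
        rw [← hv, hpt_eq]; exact hy
      · have := hNpt (y 0, y 1) (y 2)
        rw [hpt_eq] at this
        rw [this] at hyp
        have h0 := congrArg (fun z : E3 => z 0) hyp
        have h1 := congrArg (fun z : E3 => z 1) hyp
        simp only [hpt0, hpt1] at h0 h1
        exact Prod.ext h0 h1
    · rintro ⟨q, hq, rfl⟩
      refine ⟨pt q (ε * u), hq, ?_⟩
      rw [hNpt, ← mul_assoc, hε2, one_mul]
  -- `ψ` is a planar isometry, hence measure preserving
  set T₂ : EuclideanSpace ℝ (Fin 2) ≃ᵐ ℝ × ℝ :=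
    (MeasurableEquiv.toLp 2 (Fin 2 → ℝ)).symm.trans MeasurableEquiv.finTwoArrow with hT₂
  have hT₂mp : MeasurePreserving T₂ volume volume :=
    (EuclideanSpace.volume_preserving_symm_measurableEquiv_toLp (Fin 2)).trans
      (volume_preserving_finTwoArrow ℝ)
  have hT₂apply : ∀ x : EuclideanSpace ℝ (Fin 2), T₂ x = (x 0, x 1) := fun x => rfl
  set emb : EuclideanSpace ℝ (Fin 2) → E3 := fun x => pt (x 0, x 1) 0 with hemb
  set φ₀ : EuclideanSpace ℝ (Fin 2) →ₗ[ℝ] EuclideanSpace ℝ (Fin 2) :=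
    { toFun := fun x => !₂[(N (emb x)) 0, (N (emb x)) 1]
      map_add' := by
        intro x y
        have : emb (x + y) = emb x + emb y := by
          ext i; fin_cases i <;> simp [hemb, hpt, hmeq]
        ext i; fin_cases i <;> simp [this, map_add]
      map_smul' := by
        intro c x
        have : emb (c • x) = c • emb x := by
          ext i; fin_cases i <;> simp [hemb, hpt, hmeq]
        ext i; fin_cases i <;> simp [this, map_smul] } with hφ₀
  have hφ₀apply : ∀ x, φ₀ x = !₂[(N (emb x)) 0, (N (emb x)) 1] := fun x => rfl
  have hnormsq3 : ∀ z : E3, ‖z‖ ^ 2 = z 0 ^ 2 + z 1 ^ 2 + z 2 ^ 2 := by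
    intro z
    rw [EuclideanSpace.norm_eq, Real.sq_sqrt (Finset.sum_nonneg fun i _ => sq_nonneg _),
      Fin.sum_univ_three]
    simp only [Real.norm_eq_abs, sq_abs]
  have hnormsq2 : ∀ x : EuclideanSpace ℝ (Fin 2), ‖x‖ ^ 2 = x 0 ^ 2 + x 1 ^ 2 := by
    intro x
    rw [EuclideanSpace.norm_eq, Real.sq_sqrt (Finset.sum_nonneg fun i _ => sq_nonneg _),
      Fin.sum_univ_two]
    simp only [Real.norm_eq_abs, sq_abs]
  have hφ₀norm : ∀ x, ‖φ₀ x‖ = ‖x‖ := by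
    intro x
    have h3 : ‖N (emb x)‖ = ‖emb x‖ := N.norm_map _
    have hsq : ‖φ₀ x‖ ^ 2 = ‖x‖ ^ 2 := by
      rw [hnormsq2, hnormsq2 x, hφ₀apply]
      have e1 := hnormsq3 (N (emb x))
      have e2 := hnormsq3 (emb x)
      rw [h3] at e1
      have hz : (N (emb x)) 2 = 0 := by rw [hN2]; simp [hemb, hpt2]
      have hx0 : (emb x) 0 = x 0 := rfl
      have hx1 : (emb x) 1 = x 1 := rfl
      have hx2 : (emb x) 2 = 0 := rfl
      simp only [hz, hx0, hx1, hx2] at e1 e2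
      simp
      nlinarith [e1, e2]
    have h0 : 0 ≤ ‖φ₀ x‖ := norm_nonneg _
    have h1 : 0 ≤ ‖x‖ := norm_nonneg _
    nlinarith [hsq, h0, h1]
  set φ : EuclideanSpace ℝ (Fin 2) ≃ₗᵢ[ℝ] EuclideanSpace ℝ (Fin 2) :=
    (LinearIsometry.mk φ₀ hφ₀norm).toLinearIsometryEquiv rfl with hφ
  have hφapply : ∀ x, φ x = φ₀ x := fun x => rfl
  set Θ : ℝ × ℝ ≃ᵐ ℝ × ℝ := T₂.symm.trans (φ.toHomeomorph.toMeasurableEquiv.trans T₂) with hΘ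
  have hΘmp : MeasurePreserving Θ volume volume :=
    hT₂mp.symm.trans (φ.measurePreserving.trans hT₂mp)
  have hΘψ : ∀ p, Θ p = ψ p := by
    intro p
    show T₂ (φ (T₂.symm p)) = ψ p
    rw [hφapply, hT₂apply, hφ₀apply]
    have hemb' : emb (T₂.symm p) = pt p 0 := by
      ext i; fin_cases i <;> rfl
    simp [hemb', hψ]
  have hψvol : ∀ X : Set (ℝ × ℝ), MeasurableSet X → volume (ψ '' X) = volume X := by
    intro X hX
    have h1 : ψ '' X = Θ '' X := by
      ext p; simp only [mem_image, hΘψ]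
    rw [h1, MeasurableEquiv.image_eq_preimage_symm]
    exact hΘmp.symm.measure_preimage hX.nullMeasurableSet
  -- conclusion
  rw [hslice, hψvol _ (Chimera.measurableSet_slice3 ((MeasurableEquiv.measurableSet_image _).2 hS) _)]
  rcases hε with h | h
  · rw [h, one_mul]
  · rw [h, neg_one_mul]
    have hneg : {q : ℝ × ℝ | (![q.1, q.2, -u] : Fin 3 → ℝ) ∈ meq '' S} =
        (-1 : ℝ) • {q : ℝ × ℝ | (![q.1, q.2, u] : Fin 3 → ℝ) ∈ meq '' S} := by
      ext q
      rw [Set.mem_smul_set_iff_inv_smul_mem₀ (by norm_num : (-1 : ℝ) ≠ 0), mem_setOf_eq, mem_setOf_eq,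
        hmem, hmem]
      have hq : pt ((-1 : ℝ)⁻¹ • q) u = -(pt q (-u)) := by
        ext i; fin_cases i <;> simp [hpt, hmeq]
      rw [hq, ← Set.mem_neg, hSsymm]
    rw [hneg, Chimera.volume_smul_real2]
    simp

/-! ### The chimera lower bound for basal-lamellar co-axial textures -/

/-- Lamellae of a strictly increasing height sequence are disjoint: a height lies in at most one
open lamella. -/
theorem lamella_index_unique {n : ℕ} {a : Fin (n + 1) → ℝ} (ha : StrictMono a) {t : ℝ} {f f' : Fin n}
    (hf : a f.castSucc < t ∧ t < a f.succ) (hf' : a f'.castSucc < t ∧ t < a f'.succ) : f = f' := by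
  by_contra hne
  rcases lt_or_gt_of_ne hne with h | h
  · have h1 : f.succ ≤ f'.castSucc := Fin.castSucc_lt_iff_succ_le.1 (Fin.castSucc_lt_castSucc_iff.2 h)
    have h2 : a f.succ ≤ a f'.castSucc := ha.monotone h1
    linarith [hf.2, hf'.1]
  · have h1 : f'.succ ≤ f.castSucc := Fin.castSucc_lt_iff_succ_le.1 (Fin.castSucc_lt_castSucc_iff.2 h)
    have h2 : a f'.succ ≤ a f.castSucc := ha.monotone h1
    linarith [hf.1, hf'.2]

/-- **Chimera lower bound for basal-lamellar co-axial textures.**  Let `E` be measurable, cut by the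
planes `⟪x, m⟫ = a_0 < … < a_n` into lamellae `G_f = E ∩ {a_f < ⟪x,m⟫ < a_{f+1}}` carrying frames `A_f`
each satisfying the self-clause `Ax m (A f) (A f)` of the crux (embedded in a Barlow stacking of axis
`m`), with `0 < |⋃ G_f| < ∞`.  If a measurable `C` contains `x + r·w` for every `x ∈ G_f`,
`w ∈ W(A f)` (`r > 0`), then `|⋃ G_f|^{1/3} + r·32^{1/3} ≤ |C|^{1/3}`. -/
theorem lamellar_chimera_lower (m : E3) {n : ℕ} (a : Fin (n + 1) → ℝ) (ha : StrictMono a)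
    (E : Set E3) (hE : MeasurableSet E) (A : Fin n → (E3 ≃ₗᵢ[ℝ] E3))
    (hAx : ∀ f, ∃ (L : E3 ≃ₗᵢ[ℝ] E3) (s₁ s₂ : E3) (σ σ' : ℤ → ℤ), IsHaggSeq σ ∧ IsHaggSeq σ' ∧
      L (EuclideanSpace.single (2 : Fin 3) (1 : ℝ)) = m ∧
      A f '' fccStacking 1 (Real.sqrt (2 / 3)) ⊆
        (fun q => L q + s₁) '' barlowStacking 1 (Real.sqrt (2 / 3)) σ ∧
      A f '' fccStacking 1 (Real.sqrt (2 / 3)) ⊆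
        (fun q => L q + s₂) '' barlowStacking 1 (Real.sqrt (2 / 3)) σ')
    (h0 : volume (⋃ f : Fin n, E ∩ {x : E3 | a f.castSucc < ⟪x, m⟫_ℝ ∧ ⟪x, m⟫_ℝ < a f.succ}) ≠ 0)
    (htop : volume (⋃ f : Fin n, E ∩ {x : E3 | a f.castSucc < ⟪x, m⟫_ℝ ∧ ⟪x, m⟫_ℝ < a f.succ}) ≠ ⊤)
    {r : ℝ} (hr : 0 < r) {C : Set E3} (hC : MeasurableSet C)
    (hsub : ∀ f, ∀ x ∈ E ∩ {x : E3 | a f.castSucc < ⟪x, m⟫_ℝ ∧ ⟪x, m⟫_ℝ < a f.succ},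
      ∀ w ∈ {y : E3 | ∀ ν : E3, ⟪y, ν⟫_ℝ ≤ Real.sqrt 2 / 4 *
        ∑ᶠ w ∈ {w | w ∈ fccStacking 1 (Real.sqrt (2 / 3)) ∧ ‖w‖ = 1}, |⟪w, (A f).symm ν⟫_ℝ|},
      x + r • w ∈ C) :
    volume (⋃ f : Fin n, E ∩ {x : E3 | a f.castSucc < ⟪x, m⟫_ℝ ∧ ⟪x, m⟫_ℝ < a f.succ}) ^ ((3 : ℕ)⁻¹ : ℝ) +
        ENNReal.ofReal r * (ENNReal.ofReal 32) ^ ((3 : ℕ)⁻¹ : ℝ) ≤ volume C ^ ((3 : ℕ)⁻¹ : ℝ) := by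
  classical
  set e₂ : E3 := EuclideanSpace.single (2 : Fin 3) (1 : ℝ) with he₂
  set slab : Fin n → Set E3 := fun f => {x : E3 | a f.castSucc < ⟪x, m⟫_ℝ ∧ ⟪x, m⟫_ℝ < a f.succ}
    with hslab
  set E' : Set E3 := ⋃ f : Fin n, E ∩ slab f with hE'
  set W₁ : Set E3 := {y : E3 | ∀ ν : E3, ⟪y, ν⟫_ℝ ≤ Real.sqrt 2 / 4 *
    ∑ᶠ w ∈ {w | w ∈ fccStacking 1 (Real.sqrt (2 / 3)) ∧ ‖w‖ = 1},
      |⟪w, (LinearIsometryEquiv.refl ℝ E3).symm ν⟫_ℝ|} with hW₁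
  -- a lamella is occupied, whence a frame `L₀` with `L₀ e₂ = m`
  obtain ⟨x₀, hx₀⟩ := nonempty_of_measure_ne_zero h0
  obtain ⟨f₀, -⟩ := mem_iUnion.1 hx₀
  obtain ⟨L₀, -, -, -, -, -, -, hL₀m, -, -⟩ := hAx f₀
  have hL₀symm : L₀.symm m = e₂ := by rw [← hL₀m, LinearIsometryEquiv.symm_apply_apply]
  -- the transport `T = coords ∘ L₀⁻¹`
  set meq : E3 ≃ᵐ (Fin 3 → ℝ) := (MeasurableEquiv.toLp 2 (Fin 3 → ℝ)).symm with hmeq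
  set T : E3 ≃ᵐ (Fin 3 → ℝ) := L₀.symm.toHomeomorph.toMeasurableEquiv.trans meq with hT
  have hTapply : ∀ x, T x = meq (L₀.symm x) := fun x => rfl
  have hTmp : MeasurePreserving T volume volume :=
    L₀.symm.measurePreserving.trans (EuclideanSpace.volume_preserving_symm_measurableEquiv_toLp (Fin 3))
  have hmeq_mp : MeasurePreserving meq volume volume :=
    EuclideanSpace.volume_preserving_symm_measurableEquiv_toLp (Fin 3)
  have hTvol : ∀ X : Set E3, MeasurableSet X → volume (T '' X) = volume X := fun X hX => by
    rw [MeasurableEquiv.image_eq_preimage_symm]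
    exact hTmp.symm.measure_preimage hX.nullMeasurableSet
  have hT2 : ∀ x : E3, (T x) 2 = ⟪x, m⟫_ℝ := by
    intro x
    rw [hTapply]
    show (L₀.symm x) 2 = ⟪x, m⟫_ℝ
    have h1 : (L₀.symm x) 2 = ⟪L₀.symm x, e₂⟫_ℝ := by
      rw [he₂, EuclideanSpace.inner_single_right]; simp
    rw [h1, ← hL₀symm, LinearIsometryEquiv.inner_map_map]
  have hTadd : ∀ x y : E3, T (x + y) = T x + T y := fun x y => by
    rw [hTapply, hTapply, hTapply, map_add]; rfl
  have hTsmul : ∀ (c : ℝ) (x : E3), T (c • x) = c • T x := fun c x => by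
    rw [hTapply, hTapply, map_smul]; rfl
  -- frames of the lamellae
  have hframe : ∀ f, ∃ M : E3 ≃ₗᵢ[ℝ] E3,
      {y : E3 | ∀ ν : E3, ⟪y, ν⟫_ℝ ≤ Real.sqrt 2 / 4 *
          ∑ᶠ w ∈ {w | w ∈ fccStacking 1 (Real.sqrt (2 / 3)) ∧ ‖w‖ = 1}, |⟪w, (A f).symm ν⟫_ℝ|} =
        M '' W₁ ∧ (M e₂ = m ∨ M e₂ = -m) := fun f => exists_frame_cruxWulffBody (hAx f)
  choose M hWM hMe using hframe
  -- in the transported coordinates every body is an isometric image of `r • W₁` fixing the axis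
  have hW₁c : IsCompact W₁ := isCompact_cruxWulffBody _
  have hS : MeasurableSet (r • W₁) := (hW₁c.smul r).isClosed.measurableSet
  have hSsymm : -(r • W₁) = r • W₁ := by
    rw [← Set.smul_set_neg, neg_cruxWulffBody_eq]
  have hbody : ∀ f, T '' (r • {y : E3 | ∀ ν : E3, ⟪y, ν⟫_ℝ ≤ Real.sqrt 2 / 4 *
      ∑ᶠ w ∈ {w | w ∈ fccStacking 1 (Real.sqrt (2 / 3)) ∧ ‖w‖ = 1}, |⟪w, (A f).symm ν⟫_ℝ|}) =
      meq '' (((M f).trans L₀.symm) '' (r • W₁)) := by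
    intro f
    rw [hWM f]
    ext z
    simp only [mem_image, hTapply]
    constructor
    · rintro ⟨x, hx, rfl⟩
      obtain ⟨y, hy, rfl⟩ := Set.mem_smul_set.1 hx
      obtain ⟨w, hw, rfl⟩ := hy
      exact ⟨L₀.symm (r • M f w), ⟨r • w, Set.smul_mem_smul_set hw, by simp [map_smul]⟩, rfl⟩
    · rintro ⟨y, ⟨v, hv, rfl⟩, rfl⟩
      obtain ⟨w, hw, rfl⟩ := Set.mem_smul_set.1 hv
      exact ⟨r • M f w, Set.smul_mem_smul_set ⟨w, hw, rfl⟩, by simp [map_smul]⟩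
  have hNe : ∀ f, ∃ ε : ℝ, (ε = 1 ∨ ε = -1) ∧ ((M f).trans L₀.symm) e₂ = ε • e₂ := by
    intro f
    rcases hMe f with h | h
    · exact ⟨1, Or.inl rfl, by
        rw [LinearIsometryEquiv.coe_trans, Function.comp_apply, h, hL₀symm, one_smul]⟩
    · exact ⟨-1, Or.inr rfl, by
        rw [LinearIsometryEquiv.coe_trans, Function.comp_apply, h, map_neg, hL₀symm, neg_one_smul]⟩
  have hslice_eq : ∀ f u, volume {p : ℝ × ℝ | (![p.1, p.2, u] : Fin 3 → ℝ) ∈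
      T '' (r • {y : E3 | ∀ ν : E3, ⟪y, ν⟫_ℝ ≤ Real.sqrt 2 / 4 *
        ∑ᶠ w ∈ {w | w ∈ fccStacking 1 (Real.sqrt (2 / 3)) ∧ ‖w‖ = 1}, |⟪w, (A f).symm ν⟫_ℝ|})} =
      volume {p : ℝ × ℝ | (![p.1, p.2, u] : Fin 3 → ℝ) ∈ meq '' (r • W₁)} := by
    intro f u
    obtain ⟨ε, hε, hN⟩ := hNe f
    rw [hbody f]
    exact volume_slice3_image_eq _ hε hN hS hSsymm u
  -- the height profile
  set g : ℝ → Fin n := fun t =>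
    if h : ∃ f : Fin n, a f.castSucc < t ∧ t < a f.succ then h.choose else f₀ with hg
  have hg_eq : ∀ f t, a f.castSucc < t ∧ t < a f.succ → g t = f := by
    intro f t ht
    have hex : ∃ f : Fin n, a f.castSucc < t ∧ t < a f.succ := ⟨f, ht⟩
    have h1 : g t = hex.choose := by simp only [hg, dif_pos hex]
    rw [h1]
    exact lamella_index_unique ha hex.choose_spec ht
  -- the chimera inequality in the transported coordinates
  set Wt : ℝ → Set (Fin 3 → ℝ) := fun t => T '' (r • {y : E3 | ∀ ν : E3, ⟪y, ν⟫_ℝ ≤ Real.sqrt 2 / 4 *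
    ∑ᶠ w ∈ {w | w ∈ fccStacking 1 (Real.sqrt (2 / 3)) ∧ ‖w‖ = 1}, |⟪w, (A (g t)).symm ν⟫_ℝ|}) with hWt
  set W₀ : Set (Fin 3 → ℝ) := meq '' (r • W₁) with hW₀
  have hslabm : ∀ f, MeasurableSet (slab f) := fun f =>
    (continuous_id.inner continuous_const).measurable (measurableSet_Ioo (a := a f.castSucc) (b := a f.succ))
  have hE'm : MeasurableSet E' := MeasurableSet.iUnion fun f => hE.inter (hslabm f)
  have hbodym : ∀ f, MeasurableSet (r • {y : E3 | ∀ ν : E3, ⟪y, ν⟫_ℝ ≤ Real.sqrt 2 / 4 *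
      ∑ᶠ w ∈ {w | w ∈ fccStacking 1 (Real.sqrt (2 / 3)) ∧ ‖w‖ = 1}, |⟪w, (A f).symm ν⟫_ℝ|}) :=
    fun f => ((isCompact_cruxWulffBody (A f)).smul r).isClosed.measurableSet
  have hchim := Chimera.chimera3_brunnMinkowski (A := T '' E') (C := T '' C) (W₀ := W₀) Wt
    ((MeasurableEquiv.measurableSet_image _).2 hE'm) ((MeasurableEquiv.measurableSet_image _).2 hC)
    ((MeasurableEquiv.measurableSet_image _).2 hS)
    (fun t => (MeasurableEquiv.measurableSet_image _).2 (hbodym _))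
    (fun t u => (hslice_eq (g t) u).symm.le)
    (by
      rintro z ⟨x, hx, rfl⟩ w hw
      obtain ⟨f, hxf⟩ := mem_iUnion.1 hx
      have hgt : g ((T x) 2) = f := hg_eq f _ (by rw [hT2]; exact hxf.2)
      have hw' : w ∈ T '' (r • {y : E3 | ∀ ν : E3, ⟪y, ν⟫_ℝ ≤ Real.sqrt 2 / 4 *
          ∑ᶠ w ∈ {w | w ∈ fccStacking 1 (Real.sqrt (2 / 3)) ∧ ‖w‖ = 1}, |⟪w, (A f).symm ν⟫_ℝ|}) := by
        rw [← hgt]; exact hw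
      obtain ⟨v, hv, rfl⟩ := hw'
      obtain ⟨w', hw'1, rfl⟩ := Set.mem_smul_set.1 hv
      refine ⟨x + r • w', hsub f x hxf w' hw'1, ?_⟩
      rw [hTadd])
    (by rw [hTvol _ hE'm]; exact h0) (by rw [hTvol _ hE'm]; exact htop)
    (by
      rw [hW₀, MeasurableEquiv.image_eq_preimage_symm, hmeq_mp.symm.measure_preimage hS.nullMeasurableSet,
        Measure.addHaar_smul, finrank_euclideanSpace, Fintype.card_fin, volume_cruxWulffBody,
        abs_of_pos (pow_pos hr 3)]
      exact mul_ne_zero (ENNReal.ofReal_pos.2 (by positivity)).ne' (ENNReal.ofReal_pos.2 (by norm_num)).ne')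
    (by
      rw [hW₀, MeasurableEquiv.image_eq_preimage_symm, hmeq_mp.symm.measure_preimage hS.nullMeasurableSet,
        Measure.addHaar_smul]
      exact ENNReal.mul_ne_top ENNReal.ofReal_ne_top (isCompact_cruxWulffBody _).measure_lt_top.ne)
  -- read off the volumes
  have hvW₀ : volume W₀ = ENNReal.ofReal (r ^ 3) * ENNReal.ofReal 32 := by
    rw [hW₀, MeasurableEquiv.image_eq_preimage_symm, hmeq_mp.symm.measure_preimage hS.nullMeasurableSet,
      Measure.addHaar_smul, finrank_euclideanSpace, Fintype.card_fin, volume_cruxWulffBody,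
      abs_of_pos (pow_pos hr 3)]
  have hroot : (ENNReal.ofReal (r ^ 3) * ENNReal.ofReal 32) ^ ((3 : ℕ)⁻¹ : ℝ) =
      ENNReal.ofReal r * ENNReal.ofReal 32 ^ ((3 : ℕ)⁻¹ : ℝ) := by
    rw [ENNReal.mul_rpow_of_nonneg _ _ (by positivity), ENNReal.ofReal_rpow_of_nonneg (by positivity)
      (by positivity), Real.pow_rpow_inv_natCast hr.le (by norm_num)]
  rw [hTvol _ hE'm, hTvol _ hC, hvW₀, hroot] at hchim
  exact hchim

end Summit.Ventures.Crystal3D.Theorems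

end
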